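import Summits.AnomalousDissipation.AnomalousDissipation.Theorems.ScalarAnomalySteadySourceFormal.Negative.KillShape
import Summits.AnomalousDissipation.AnomalousDissipation.Theorems.ScalarAnomalySteadySourceFormal.Negative.ForcedClassicalWeak
import Literature.Analysis.FluidPDE.PassiveScalarFourier
import Literature.Analysis.FluidPDE.PassiveScalarEnergySlice
import Literature.Analysis.FluidPDE.TorusClassicalLerayHopfProofs
import Literature.Analysis.FluidPDE.EulerReynolds
import Literature.Analysis.FluidPDE.TorusForceBookkeeping
import Literature.Analysis.FunctionSpaces.TorusCalculusProofs

/-!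
# Negative knowledge for the crux `ScalarAnomalySteadySourceFormal` (stmt-AnomalousDissipation-0448), III-a:
# one-mode calculus, the flow at rest, the steady heat profile

Certified copy of §3.2–§3.3 of the cdisprove work file: `cosMode` calculus on `T²` (`laplacian_cosMode`,
`hasZeroMean_cosMode`, `∫cos² = 1/2`, `toReal_eScalarGradNormSq_of_eigen`: `‖∇A‖² = λ∫A²` for
`ΔA = -λA` in the crux's spectral norm); the flow at rest is a global Leray–Hopf solution
(`isGlobalLerayHopf_rest`; the crux has no `g ≠ 0` clause); the steady heat profile
`a cos(2πk·x)/(νλ_k)` is a classical, hence weak, sourced solution with HONEST constant means.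
Supports stmt-AnomalousDissipation-0448.
-/

set_option linter.dupNamespace false

noncomputable section

open scoped BigOperators Topology ENNReal NNReal InnerProductSpace ContDiff
open Filter Set Function MeasureTheory UnitAddTorus Complex

namespace Summit.AnomalousDissipation.AnomalousDissipation.Theorems.ScalarAnomalySteadySourceFormal.Negative

open Literature.Analysis
open Literature.Analysis.FunctionSpaces Literature.Analysis.FunctionSpaces.Torus
open Literature.Analysis.FluidPDE Literature.Analysis.FluidPDE.Torus
open Summit.AnomalousDissipation.AnomalousDissipation.Theses.TwoAndHalfD

/-! ### One-mode scalar calculus on `T²` -/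

section CosMode

/-- The one-mode real scalar `a cos(2π k·x)` on `T²`, written as `Re (a e_{-k}(x))`
(a real part of a one-mode trigonometric polynomial, so that the tree's mode calculus applies). [folklore] -/
def cosMode (k : Fin 2 → ℤ) (a : ℝ) : (UnitAddTorus (Fin 2)) → ℝ :=
  fun y => (trigPoly {-k} (fun _ => (a : ℂ)) y).re

/-- Unfolding: `cosMode k a x = a · Re e_{-k}(x)`. [folklore] -/
theorem cosMode_apply (k : Fin 2 → ℤ) (a : ℝ) (x : (UnitAddTorus (Fin 2))) :
    cosMode k a x = a * (mFourier (-k) x).re := by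
  rw [cosMode, trigPoly_singleton_const, Complex.re_ofReal_mul]

/-- Linearity in the amplitude. [folklore] -/
theorem cosMode_mul (k : Fin 2 → ℤ) (c a : ℝ) : cosMode k (c * a) = fun x => c * cosMode k a x := by
  funext x
  rw [cosMode_apply, cosMode_apply, mul_assoc]

/-- One-mode scalars are smooth. [folklore] -/
theorem isSmooth_cosMode (k : Fin 2 → ℤ) (a : ℝ) : IsSmooth (cosMode k a) :=
  isSmooth_re_trigPoly _ _

/-- One-mode scalars are continuous. [folklore] -/
theorem continuous_cosMode (k : Fin 2 → ℤ) (a : ℝ) : Continuous (cosMode k a) :=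
  (isSmooth_cosMode k a).continuous

/-- `|e_n(x)| = 1`. [folklore] -/
theorem norm_mFourier_apply' (n : Fin 2 → ℤ) (x : (UnitAddTorus (Fin 2))) : ‖mFourier n x‖ = 1 := by
  simp [mFourier]

/-- `|a cos(2πk·x)| ≤ |a|`. [folklore] -/
theorem abs_cosMode_le (k : Fin 2 → ℤ) (a : ℝ) (x : (UnitAddTorus (Fin 2))) : |cosMode k a x| ≤ |a| := by
  rw [cosMode_apply, abs_mul]
  have h : |(mFourier (-k) x).re| ≤ 1 :=
    (Complex.abs_re_le_norm _).trans_eq (norm_mFourier_apply' _ _)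
  exact mul_le_of_le_one_right (abs_nonneg a) h

/-- **Laplace eigenfunction**: `Δ (a cos(2πk·x)) = -4π²|k|² · a cos(2πk·x)`. [folklore] -/
theorem laplacian_cosMode (k : Fin 2 → ℤ) (a : ℝ) (x : (UnitAddTorus (Fin 2))) :
    laplacian (cosMode k a) x = -(4 * Real.pi ^ 2 * freqNormSq k) * cosMode k a x := by
  have h := laplacian_re_oneMode k (a : ℂ) x
  calc laplacian (cosMode k a) x
        = (-((4 * Real.pi ^ 2 * freqNormSq k : ℝ) : ℂ) * (a : ℂ) * mFourier (-k) x).re := h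
    _ = -(4 * Real.pi ^ 2 * freqNormSq k) * cosMode k a x := by
        rw [cosMode_apply, ← mul_assoc, ← Complex.re_ofReal_mul]
        congr 1
        push_cast
        ring

/-- `a cos(2πk·0) = a`. [folklore] -/
theorem cosMode_zero_pt (k : Fin 2 → ℤ) (a : ℝ) : cosMode k a 0 = a := by
  rw [cosMode_apply]
  simp [mFourier]

/-- `∫ a cos(2πk·x) dx = 0` for `k ≠ 0`. [folklore] -/
theorem integral_cosMode {k : Fin 2 → ℤ} (hk : k ≠ 0) (a : ℝ) : ∫ x, cosMode k a x = 0 := by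
  simp_rw [cosMode_apply]
  have hint : Integrable (fun x : (UnitAddTorus (Fin 2)) => (a : ℂ) * mFourier (-k) x) volume :=
    ((continuous_const.mul (mFourier (-k)).continuous)).integrable_unitAddTorus
  have hre := integral_re hint
  simp only [RCLike.re_to_complex] at hre
  have h2 : (fun x : (UnitAddTorus (Fin 2)) => ((a : ℂ) * mFourier (-k) x).re) = fun x => a * (mFourier (-k) x).re :=
    funext fun x => Complex.re_ofReal_mul _ _
  rw [← h2, hre, integral_const_mul, integral_mFourier, if_neg (neg_ne_zero.2 hk), mul_zero,
    Complex.zero_re]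

/-- One-mode scalars with `k ≠ 0` have zero mean. [folklore] -/
theorem hasZeroMean_cosMode {k : Fin 2 → ℤ} (hk : k ≠ 0) (a : ℝ) : HasZeroMean (cosMode k a) :=
  integral_cosMode hk a

/-- `cos² = (1 + cos 2·)/2`: `(cos(2πk·x))² = 1/2 + cos(2π(2k)·x)/2` (from `|e_{-k}(x)| = 1` and
`e_{-k}² = e_{-2k}`). [folklore] -/
theorem cosMode_one_sq (k : Fin 2 → ℤ) (x : (UnitAddTorus (Fin 2))) :
    cosMode k 1 x ^ 2 = 1 / 2 + (1 / 2) * cosMode (k + k) 1 x := by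
  rw [cosMode_apply, cosMode_apply, one_mul, one_mul, neg_add, mFourier_add]
  set w : ℂ := mFourier (-k) x with hw
  have hn : ‖w‖ = 1 := norm_mFourier_apply' _ _
  have h1 : w.re ^ 2 + w.im ^ 2 = 1 := by
    have := Complex.sq_norm w
    rw [hn, Complex.normSq_apply] at this
    nlinarith [this]
  rw [Complex.mul_re]
  nlinarith [h1]

/-- `∫ cos²(2πk·x) dx = 1/2` for `k ≠ 0`. [folklore] -/
theorem integral_cosMode_one_sq {k : Fin 2 → ℤ} (hk : k ≠ 0) : ∫ x, cosMode k 1 x ^ 2 = 1 / 2 := by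
  simp_rw [cosMode_one_sq]
  have hkk : k + k ≠ 0 := by
    rw [← two_smul ℕ k]
    exact smul_ne_zero two_ne_zero hk
  have hint : Integrable (fun x : (UnitAddTorus (Fin 2)) => (1 / 2 : ℝ) * cosMode (k + k) 1 x) volume :=
    (continuous_const.mul (continuous_cosMode _ _)).integrable_unitAddTorus
  rw [integral_add (integrable_const _) hint, integral_const_mul, integral_cosMode hkk, mul_zero,
    add_zero]
  simp

/-- `∫ (a cos(2πk·x))² dx = a²/2` for `k ≠ 0`. [folklore] -/
theorem integral_cosMode_sq {k : Fin 2 → ℤ} (hk : k ≠ 0) (a : ℝ) :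
    ∫ x, cosMode k a x ^ 2 = a ^ 2 / 2 := by
  have h : cosMode k a = fun x => a * cosMode k 1 x := by rw [← cosMode_mul, mul_one]
  rw [h]
  simp_rw [mul_pow]
  rw [integral_const_mul, integral_cosMode_one_sq hk]
  ring

/-- `‖a cos(2πk·x)‖²_{L²} = a²/2`. [folklore] -/
theorem scalarL2Sq_cosMode {k : Fin 2 → ℤ} (hk : k ≠ 0) (a : ℝ) :
    scalarL2Sq (cosMode k a) = a ^ 2 / 2 :=
  integral_cosMode_sq hk a

/-- **Dirichlet form of a Laplace eigenfunction**: if `ΔA = -λA` pointwise for a smooth real `A`,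
then `‖∇A‖₂² = λ ∫ A²` for the SPECTRAL `eScalarGradNormSq` (`toReal`) of the crux
(`eScalarGradNormSq_eq_ofReal_integral` + Green's identity `∫ A ΔA = -∑ᵢ ∫ (∂ᵢA)²`). [folklore] -/
theorem toReal_eScalarGradNormSq_of_eigen {A : (UnitAddTorus (Fin 2)) → ℝ} (hA : IsSmooth A) {lam : ℝ}
    (hlap : ∀ x, laplacian A x = -lam * A x) :
    (eScalarGradNormSq A).toReal = lam * ∫ x, A x ^ 2 := by
  rw [eScalarGradNormSq_eq_ofReal_integral hA,
    ENNReal.toReal_ofReal (integral_nonneg fun _ => sq_nonneg _)]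
  have hA1 : IsContDiff 1 A := hA.isContDiff (by simp)
  have hpt : ∀ x, ‖gradient A x‖ ^ 2 = ∑ i, ‖partialDeriv i A x‖ ^ 2 := fun x => by
    rw [EuclideanSpace.norm_sq_eq]
    refine Finset.sum_congr rfl fun i _ => ?_
    rw [gradient_apply hA1]
  simp_rw [hpt]
  rw [integral_finsetSum _ fun i _ => ((hA.partialDeriv i).norm_sq).integrable]
  have hG := integral_inner_laplacian_eq_neg_holds (d := Fin 2) (G := ℝ) hA
  have hinner : (fun x => ⟪A x, laplacian A x⟫_ℝ) = fun x => -lam * A x ^ 2 := by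
    funext x
    rw [hlap x, real_inner_eq_re_inner, RCLike.inner_apply]
    simp; ring
  rw [hinner, integral_const_mul] at hG
  linarith

/-- `‖∇(a cos(2πk·x))‖₂² = 4π²|k|² · a²/2` (spectral, `toReal`). [folklore] -/
theorem toReal_eScalarGradNormSq_cosMode {k : Fin 2 → ℤ} (hk : k ≠ 0) (a : ℝ) :
    (eScalarGradNormSq (cosMode k a)).toReal = 4 * Real.pi ^ 2 * freqNormSq k * (a ^ 2 / 2) := by
  rw [toReal_eScalarGradNormSq_of_eigen (isSmooth_cosMode k a) (lam := 4 * Real.pi ^ 2 * freqNormSq k)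
    (fun x => laplacian_cosMode k a x), integral_cosMode_sq hk]

/-- The axial frequencies `n e₀ = (n, 0)`. [folklore] -/
def axialFreq (n : ℤ) : Fin 2 → ℤ := Pi.single 0 n

/-- `|(n,0)|² = n²`. [folklore] -/
theorem freqNormSq_axialFreq (n : ℤ) : freqNormSq (axialFreq n) = (n : ℝ) ^ 2 := by
  simp [freqNormSq, axialFreq, Fin.sum_univ_two]

/-- `(n, 0) ≠ 0` for `n ≠ 0`. [folklore] -/
theorem axialFreq_ne_zero {n : ℤ} (hn : n ≠ 0) : axialFreq n ≠ 0 := fun h => by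
  have := congrFun h 0
  simp [axialFreq] at this
  exact hn this

end CosMode

/-! ### The flow at rest and the steady heat profile -/

section Heat

/-- **The flow at rest is a classical Navier–Stokes solution** for the zero force (every
viscosity, zero pressure). [folklore] -/
theorem isClassicalNSSolutionOn_rest (ν : ℝ) :
    FunctionSpaces.Torus.IsClassicalNSSolutionOn univ ν (fun (_ : ℝ) (_ : (UnitAddTorus (Fin 2))) => (0 : (EuclideanSpace ℝ (Fin 2))))
      (fun (_ : ℝ) (_ : (UnitAddTorus (Fin 2))) => (0 : (EuclideanSpace ℝ (Fin 2)))) (fun (_ : ℝ) (_ : (UnitAddTorus (Fin 2))) => (0 : ℝ)) where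
  smooth_velocity := contDiffOn_const
  smooth_pressure := contDiffOn_const
  momentum := fun t _ x => by simp
  divFree := fun _ _ x => divergence_zero x

/-- **The flow at rest is a global Leray–Hopf solution** for the zero force and zero datum
(`Torus.IsClassicalNSSolutionOn.isGlobalLerayHopf`). [folklore] -/
theorem isGlobalLerayHopf_rest (ν : ℝ) :
    IsGlobalLerayHopf ν (fun (_ : ℝ) (_ : (UnitAddTorus (Fin 2))) => (0 : (EuclideanSpace ℝ (Fin 2)))) (fun _ => 0)
      (fun (_ : ℝ) (_ : (UnitAddTorus (Fin 2))) => (0 : (EuclideanSpace ℝ (Fin 2)))) :=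
  (isClassicalNSSolutionOn_rest ν).isGlobalLerayHopf

/-- The flow at rest has zero mean energy (honest). [folklore] -/
theorem meanEnergy_rest : meanEnergy (fun (_ : ℝ) (_ : (UnitAddTorus (Fin 2))) => (0 : (EuclideanSpace ℝ (Fin 2)))) = 0 := by
  rw [meanEnergy_eq_longTimeAvgSup]
  simp only [norm_zero, ne_eq, OfNat.ofNat_ne_zero, not_false_eq_true, zero_pow, integral_zero]
  exact longTimeAvgSup_const 0

/-- The zero planar force is admissible together with any one-mode source `a cos(2πk·x)`,
`k ≠ 0`. [folklore] -/
theorem isAdmissible_zero_cosMode {k : Fin 2 → ℤ} (hk : k ≠ 0) (a : ℝ) :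
    IsAdmissible (fun _ => (0 : (EuclideanSpace ℝ (Fin 2)))) (cosMode k a) where
  smooth_g := isSmooth_const _
  divFree_g := fun x => divergence_zero x
  zeroMean_g := by simp [HasZeroMean]
  smooth_h := isSmooth_cosMode k a
  zeroMean_h := hasZeroMean_cosMode hk a

/-- The Laplace eigenvalue `λ_k = 4π²|k|²`. [folklore] -/
def lam (k : Fin 2 → ℤ) : ℝ := 4 * Real.pi ^ 2 * freqNormSq k

/-- `λ_k > 0` for `k ≠ 0` … here for the axial frequencies `(n,0)`, `n ≠ 0`. [folklore] -/
theorem lam_axialFreq (n : ℤ) : lam (axialFreq n) = 4 * Real.pi ^ 2 * (n : ℝ) ^ 2 := by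
  rw [lam, freqNormSq_axialFreq]

/-- Helper `lam_pos_axialFreq` (see the section docstring). [folklore] -/
theorem lam_pos_axialFreq {n : ℤ} (hn : n ≠ 0) : 0 < lam (axialFreq n) := by
  rw [lam_axialFreq]
  have : (0 : ℝ) < (n : ℝ) ^ 2 := by positivity
  positivity

/-- **The steady heat profile** `θ_∞ = a cos(2πk·x)/(ν λ_k)`: the stationary solution of the
sourced heat equation `0 = νΔθ + a cos(2πk·x)`. [folklore] -/
def heatProfile (k : Fin 2 → ℤ) (a ν : ℝ) : (UnitAddTorus (Fin 2)) → ℝ :=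
  cosMode k (a / (ν * lam k))

/-- The steady heat profile solves the sourced advection–diffusion equation CLASSICALLY with the
flow at rest (all times, every `ν ≠ 0`, `λ_k ≠ 0`). [folklore] -/
theorem heatProfile_isClassical {k : Fin 2 → ℤ} (hlam : lam k ≠ 0) {ν : ℝ} (hν : ν ≠ 0) (a : ℝ) :
    IsClassicalScalarTransportForcedOn univ ν (fun (_ : ℝ) (_ : (UnitAddTorus (Fin 2))) => (0 : (EuclideanSpace ℝ (Fin 2))))
      (fun _ => cosMode k a) (fun _ => heatProfile k a ν) where
  smooth_velocity := contDiffOn_const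
  smooth_source := isSmoothSpaceTimeOn_const (isSmooth_cosMode k a) univ
  smooth_scalar := isSmoothSpaceTimeOn_const (isSmooth_cosMode k _) univ
  transport := fun t _ x => by
    have h0 : FunctionSpaces.Torus.timeDerivWithin univ (fun (_ : ℝ) => heatProfile k a ν) t x = 0 := by
      simp [FunctionSpaces.Torus.timeDerivWithin]
    rw [h0, inner_zero_left, zero_add, heatProfile, laplacian_cosMode, ← lam,
      cosMode_apply, cosMode_apply]
    field_simp
    ring
  divFree := fun _ _ x => divergence_zero x

/-- … hence it is a global WEAK solution of the crux's class with datum `θ_∞` itself. [folklore] -/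
theorem heatProfile_isWeak {k : Fin 2 → ℤ} (hlam : lam k ≠ 0) {ν : ℝ} (hν : ν ≠ 0) (a : ℝ) :
    IsWeakScalarTransportForced ν (fun (_ : ℝ) (_ : (UnitAddTorus (Fin 2))) => (0 : (EuclideanSpace ℝ (Fin 2)))) (fun _ => cosMode k a)
      (heatProfile k a ν) (fun _ => heatProfile k a ν) :=
  isWeakScalarTransportForced_of_classical (heatProfile_isClassical hlam hν a)

/-- The profile is an `L²` datum. [folklore] -/
theorem memLp_heatProfile (k : Fin 2 → ℤ) (a ν : ℝ) : MemLp (heatProfile k a ν) 2 volume :=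
  (isSmooth_cosMode k _).memLp 2

/-- **Honest variance** of the heat profile: `‖θ_∞‖² = a²/(2 ν² λ_k²)` at every time, … [folklore] -/
theorem scalarL2Sq_heatProfile {k : Fin 2 → ℤ} (hk : k ≠ 0) (a ν : ℝ) :
    scalarL2Sq (heatProfile k a ν) = (a / (ν * lam k)) ^ 2 / 2 :=
  scalarL2Sq_cosMode hk _

/-- … so its long-time average is the same constant (no junk). [folklore] -/
theorem longTimeAvgSup_scalarL2Sq_heatProfile {k : Fin 2 → ℤ} (hk : k ≠ 0) (a ν : ℝ) :
    longTimeAvgSup (fun _ : ℝ => scalarL2Sq (heatProfile k a ν)) = (a / (ν * lam k)) ^ 2 / 2 := by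
  rw [scalarL2Sq_heatProfile hk, longTimeAvgSup_const]

/-- **Honest dissipation** of the heat profile: `ν‖∇θ_∞‖² = a²/(2 ν λ_k)` at every time, … [folklore] -/
theorem dissipation_heatProfile {k : Fin 2 → ℤ} (hk : k ≠ 0) (hlam : lam k ≠ 0) {ν : ℝ} (hν : ν ≠ 0)
    (a : ℝ) : dissipation ν (fun _ => heatProfile k a ν) = fun _ => a ^ 2 / (2 * (ν * lam k)) := by
  funext t
  rw [dissipation, heatProfile, toReal_eScalarGradNormSq_cosMode hk, ← lam]
  field_simp

/-- … so its long-time average is `a²/(2 ν λ_k)` — of order `1/ν`. [folklore] -/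
theorem longTimeAvgSup_dissipation_heatProfile {k : Fin 2 → ℤ} (hk : k ≠ 0) (hlam : lam k ≠ 0)
    {ν : ℝ} (hν : ν ≠ 0) (a : ℝ) :
    longTimeAvgSup (dissipation ν (fun _ => heatProfile k a ν)) = a ^ 2 / (2 * (ν * lam k)) := by
  rw [dissipation_heatProfile hk hlam hν, longTimeAvgSup_const]

end Heat


end Summit.AnomalousDissipation.AnomalousDissipation.Theorems.ScalarAnomalySteadySourceFormal.Negative
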